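import Mathlib
import HarnessLib
import Literature.NumberTheory.LFunctions.SuzukiCanonicalSystem
import Literature.MathematicalPhysics.QuantumManyBody.GroundStateFeynmanKacSpectral
import Summits.RiemannHypothesis.RiemannHypothesis.Theses.SuzukiWindowsDoor

/-!
# RiemannHypothesis / SuzukiWindowsDoor — crux `WindowsImplyContraction` (A1, stmt-RiemannHypothesis-19732): the abstract core and three plumbing stubs

RH-FREE, ζ-FREE support for LINE «plumbing» of the crux A1 (registered skeleton
`rh-dbr-theory/lean/route-SuzukiWindowsDoor/bc/WindowsImplyContraction_plumbing.lean`, planner rh-dbr-theory g5;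
namespace `…Cruxes.WindowsImplyContraction.Plumbing`). Ported verbatim from the planner's farm-verified scratch
files `ports/SuzukiWindowsDoorPathContraction.scratch.lean` and `ports/SuzukiWindowsDoorPlumbing.scratch.lean`.
* CORE `pathContraction`: a norm-continuous path `T` of compact self-adjoint operators on a real Hilbert space with
  `T 0 = 0` and no eigenvalue `±1` in any window satisfies `‖T t‖ < 1` for all `t ≥ 0` — IVT
  (`exists_window_norm_eq_one`) + a top eigenvector of `(T s)∘(T s)` from the tree lemma
  `BoseGas.exists_eigenvector_norm_of_isCompactOperator` + `f± = e ± T e` (`unit_eigen_of_sq_fixed`).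
* Registered stubs BY NAME: `stub_eigenTransfer` (`NoUnitEigenvalue K t` ⟹ no `±1`-eigenvector of a representing
  operator in `L²(ℝ)`), `stub_windowIneq` (`‖𝖪[t]‖ < 1` ⟹ the A1 window inequality for `MemLp` data),
  `stub_lineOfWindows` (exhaustion `T → ∞`).
With these the crux hangs on the single remaining stub `stub_opPath` (realise `t ↦ 𝖪[t] = P_t 𝒦 P_t` as such a
path on `Lp ℝ 2 volume`). Nothing here bears on the truth of RH.
-/

noncomputable section

-- D-0017: `Summit.<S>.<S>.…` is the designed namespace of a single-problem summit.
set_option linter.dupNamespace false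

open MeasureTheory Set

namespace Summit.RiemannHypothesis.RiemannHypothesis.Cruxes.WindowsImplyContraction.Plumbing

/-- The IVT half, PROVED: if some window has norm ≥ 1 then some earlier window has norm exactly 1. -/
theorem exists_window_norm_eq_one {E : Type*} [NormedAddCommGroup E] [InnerProductSpace ℝ E]
    (T : ℝ → E →L[ℝ] E) (hc : Continuous T) (h0 : T 0 = 0) {t : ℝ} (ht : 0 ≤ t) (h1 : 1 ≤ ‖T t‖) :
    ∃ s : ℝ, 0 ≤ s ∧ s ≤ t ∧ ‖T s‖ = 1 := by
  have hcn : ContinuousOn (fun s => ‖T s‖) (Set.Icc 0 t) := (continuous_norm.comp hc).continuousOn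
  have hmem : (1 : ℝ) ∈ Set.Icc ‖T 0‖ ‖T t‖ := ⟨by rw [h0, norm_zero]; exact zero_le_one, h1⟩
  obtain ⟨s, hs, hs1⟩ := intermediate_value_Icc ht hcn hmem
  exact ⟨s, hs.1, hs.2, hs1⟩

/-- The algebraic half, PROVED: a fixed vector of `T²` yields a `±1`-eigenvector of `T` (`f± = e ± T e`). -/
theorem unit_eigen_of_sq_fixed {E : Type*} [NormedAddCommGroup E] [InnerProductSpace ℝ E]
    (A : E →L[ℝ] E) {e : E} (he : A (A e) = e) (hne : e ≠ 0) :
    ∃ v : E, v ≠ 0 ∧ (A v = v ∨ A v = -v) := by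
  by_cases h : e + A e = 0
  · refine ⟨e - A e, ?_, Or.inr ?_⟩
    · intro h'
      have : (2 : ℝ) • e = 0 := by
        rw [two_smul]
        have := congrArg₂ (· + ·) h h'
        simp only [add_zero] at this
        -- (e + A e) + (e - A e) = 2e
        calc e + e = (e + A e) + (e - A e) := by abel
          _ = 0 := by rw [h, h', add_zero]
      exact hne (by simpa using this)
    · rw [map_sub, he]
      have hAe : A e = -e := by
        have := eq_neg_of_add_eq_zero_right h
        exact this
      rw [hAe]; abel
  · refine ⟨e + A e, h, Or.inl ?_⟩
    rw [map_add, he, add_comm]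

open scoped InnerProductSpace in
/-- **Core rung (BC5 witness, sibling setting = abstract Hilbert space).** A norm-continuous path of compact
self-adjoint operators from `0` with no unit eigenvalue in any window is a strict contraction in every window.
Uses the tree lemma `exists_eigenvector_norm_of_isCompactOperator` on `T s ∘ T s`. -/
theorem pathContraction {E : Type*} [NormedAddCommGroup E] [InnerProductSpace ℝ E] [CompleteSpace E]
    (T : ℝ → E →L[ℝ] E) (hc : Continuous T) (h0 : T 0 = 0)
    (hsa : ∀ t : ℝ, 0 ≤ t → IsSelfAdjoint (T t)) (hk : ∀ t : ℝ, 0 ≤ t → IsCompactOperator (T t))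
    (hno : ∀ t : ℝ, 0 ≤ t → ∀ v : E, (T t v = v ∨ T t v = -v) → v = 0) :
    ∀ t : ℝ, 0 ≤ t → ‖T t‖ < 1 := by
  intro t ht
  by_contra hge
  push Not at hge
  obtain ⟨s, hs0, -, hs1⟩ := exists_window_norm_eq_one T hc h0 ht hge
  set A : E →L[ℝ] E := T s with hA
  have hsym : (A : E →ₗ[ℝ] E).IsSymmetric := (hsa s hs0).isSymmetric
  set S : E →L[ℝ] E := A.comp A with hS
  have hSapp : ∀ x : E, S x = A (A x) := fun x => rfl
  have hinner : ∀ x : E, ⟪S x, x⟫_ℝ = ‖A x‖ ^ 2 := by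
    intro x
    rw [hSapp, ← real_inner_self_eq_norm_sq]
    exact hsym (A x) x
  have hSk : IsCompactOperator S := (hk s hs0).comp_clm A
  have hSle : ‖S‖ ≤ 1 := by
    calc ‖S‖ ≤ ‖A‖ * ‖A‖ := A.opNorm_comp_le A
      _ = 1 := by rw [hs1]; norm_num
  -- Rayleigh lower bound: ⟪S u, u⟫ ≤ ‖S‖ for unit u
  have hRay : ∀ u : E, ‖u‖ = 1 → ⟪S u, u⟫_ℝ ≤ ‖S‖ := by
    intro u hu
    calc ⟪S u, u⟫_ℝ ≤ ‖S u‖ * ‖u‖ := real_inner_le_norm _ _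
      _ ≤ ‖S‖ * ‖u‖ * ‖u‖ := by gcongr; exact S.le_opNorm u
      _ = ‖S‖ := by rw [hu]; ring
  -- unit vectors with ‖A u‖² close to 1
  have hunit : ∀ ε : ℝ, 0 < ε → ε ≤ 1 → ∃ u : E, ‖u‖ = 1 ∧ 1 - ε < ‖A u‖ ^ 2 := by
    intro ε hε hε1
    obtain ⟨x, hx1, hrx⟩ := A.exists_lt_apply_of_lt_opNorm (r := 1 - ε / 2) (by rw [hs1]; linarith)
    have hr0 : 0 < 1 - ε / 2 := by linarith
    have hAx : 0 < ‖A x‖ := hr0.trans hrx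
    have hx0 : x ≠ 0 := by
      intro h; rw [h, map_zero, norm_zero] at hAx; exact lt_irrefl _ hAx
    have hxn : 0 < ‖x‖ := norm_pos_iff.2 hx0
    refine ⟨(‖x‖⁻¹ : ℝ) • x, norm_smul_inv_norm hx0, ?_⟩
    have hAu : ‖A ((‖x‖⁻¹ : ℝ) • x)‖ = ‖x‖⁻¹ * ‖A x‖ := by
      rw [map_smul, norm_smul, Real.norm_eq_abs, abs_of_pos (inv_pos.2 hxn)]
    have hge1 : ‖A x‖ ≤ ‖x‖⁻¹ * ‖A x‖ := by
      have : 1 ≤ ‖x‖⁻¹ := (one_le_inv₀ hxn).2 hx1.le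
      nlinarith
    have h1 : 1 - ε / 2 < ‖x‖⁻¹ * ‖A x‖ := hrx.trans_le hge1
    rw [hAu]
    nlinarith
  -- hence ‖S‖ = 1 and S ≠ 0
  have hSge : 1 ≤ ‖S‖ := by
    by_contra hlt
    push Not at hlt
    obtain ⟨u, hu, hAu⟩ := hunit (min 1 (1 - ‖S‖)) (lt_min one_pos (by linarith)) (min_le_left _ _)
    have := hRay u hu
    rw [hinner] at this
    have hmin : min 1 (1 - ‖S‖) ≤ 1 - ‖S‖ := min_le_right _ _
    linarith
  have hSnorm : ‖S‖ = 1 := le_antisymm hSle hSge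
  have hSne : S ≠ 0 := by
    intro h; rw [h, norm_zero] at hSnorm; exact zero_ne_one hSnorm
  have happ : ∀ ε > 0, ∃ x ∈ (Set.univ : Set E), ‖x‖ = 1 ∧ ‖S‖ - ε < ⟪S x, x⟫_ℝ := by
    intro ε hε
    obtain ⟨u, hu, hAu⟩ := hunit (min ε 1) (lt_min hε one_pos) (min_le_right _ _)
    refine ⟨u, Set.mem_univ _, hu, ?_⟩
    rw [hinner, hSnorm]
    have : min ε 1 ≤ ε := min_le_left _ _
    linarith
  obtain ⟨e, -, he1, hSe⟩ :=
    Literature.MathematicalPhysics.QuantumManyBody.BoseGas.exists_eigenvector_norm_of_isCompactOperator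
      S hSk hSne isClosed_univ happ
  rw [hSnorm, one_smul, hSapp] at hSe
  have hne : e ≠ 0 := by
    intro h; rw [h, norm_zero] at he1; exact zero_ne_one he1
  obtain ⟨v, hv, hAv⟩ := unit_eigen_of_sq_fixed A hSe hne
  exact hv (hno s hs0 v hAv)

/-- **Registered stub `stub_eigenTransfer` of crux `WindowsImplyContraction`, LINE «plumbing» (PROVED; RH-FREE, ζ-free).**
`NoUnitEigenvalue K t` (the a.e. eigen-equation on `(−t,t)`) kills `±1`-eigenvectors in `L²(ℝ)` of any operator representing
`f ↦ 1_{(−t,t)} ∫_{(−t,t)} K(·+y) f(y) dy`. -/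
theorem stub_eigenTransfer :
    ∀ K : ℝ → ℝ, Continuous K →
      ∀ T : ℝ → (Lp ℝ 2 (volume : Measure ℝ) →L[ℝ] Lp ℝ 2 (volume : Measure ℝ)),
        (∀ t : ℝ, 0 ≤ t → ∀ f : Lp ℝ 2 (volume : Measure ℝ),
            ((T t f : Lp ℝ 2 (volume : Measure ℝ)) : ℝ → ℝ) =ᵐ[volume]
              fun x => (Ioo (-t) t).indicator (fun x => ∫ y in Ioo (-t) t, K (x + y) * f y) x) →
          ∀ t : ℝ, 0 ≤ t → Literature.NumberTheory.LFunctions.NoUnitEigenvalue K t →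
            ∀ v : Lp ℝ 2 (volume : Measure ℝ), (T t v = v ∨ T t v = -v) → v = 0 := by
  intro K _hK T hR t ht hNo v hv
  -- the sign ε with `T t v = ε • v` (as functions a.e.)
  obtain ⟨ε, hε, hεv⟩ : ∃ ε : ℝ, (ε = 1 ∨ ε = -1) ∧
      ((T t v : Lp ℝ 2 (volume : Measure ℝ)) : ℝ → ℝ) =ᵐ[volume] fun x => ε * v x := by
    rcases hv with h | h
    · exact ⟨1, Or.inl rfl, by rw [h]; exact Filter.Eventually.of_forall fun x => by simp⟩
    · refine ⟨-1, Or.inr rfl, ?_⟩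
      rw [h]
      exact (Lp.coeFn_neg v).mono fun x hx => by rw [hx, Pi.neg_apply]; ring
  have hrep := hR t ht v
  -- a.e. on ℝ: ε * v x = indicator (…) x
  have hae : ∀ᵐ x ∂(volume : Measure ℝ),
      ε * v x = (Ioo (-t) t).indicator (fun x => ∫ y in Ioo (-t) t, K (x + y) * v y) x := by
    filter_upwards [hεv, hrep] with x h1 h2
    rw [← h1, h2]
  have hε2 : ε * ε = 1 := by rcases hε with rfl | rfl <;> norm_num
  have hεne : ε ≠ 0 := by rcases hε with rfl | rfl <;> norm_num
  -- the restriction of `v` to the window solves the eigen-equation with sign ε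
  have hf : MemLp (v : ℝ → ℝ) 2 (volume.restrict (Ioo (-t) t)) := (Lp.memLp v).restrict _
  have heq : ∀ᵐ x ∂(volume.restrict (Ioo (-t) t)),
      ∫ y in Ioo (-t) t, K (x + y) * v y = ε * v x := by
    rw [ae_restrict_iff' measurableSet_Ioo]
    filter_upwards [hae] with x hx hxmem
    rw [hx, indicator_of_mem hxmem]
  have hzero : (v : ℝ → ℝ) =ᵐ[volume.restrict (Ioo (-t) t)] 0 := hNo ε hε v hf heq
  -- hence `v = 0` a.e. on ℝ
  have hzero' : ∀ᵐ x ∂(volume : Measure ℝ), x ∈ Ioo (-t) t → (v : ℝ → ℝ) x = 0 := by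
    rw [← ae_restrict_iff' measurableSet_Ioo]
    exact hzero
  have hv0 : (v : ℝ → ℝ) =ᵐ[volume] (0 : Lp ℝ 2 (volume : Measure ℝ)) := by
    filter_upwards [hae, hzero', Lp.coeFn_zero ℝ 2 (volume : Measure ℝ)] with x h1 h2 h3
    rw [h3]
    by_cases hx : x ∈ Ioo (-t) t
    · exact h2 hx
    · rw [indicator_of_notMem hx] at h1
      simpa [hεne] using h1
  exact Lp.ext hv0

/-- `‖F‖² = ∫ F²` for real `L²(ℝ)` classes. -/
theorem norm_sq_eq_integral_sq
    (F : Lp ℝ 2 (volume : Measure ℝ)) : ‖F‖ ^ 2 = ∫ x, (F x) ^ 2 := by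
  rw [← real_inner_self_eq_norm_sq, MeasureTheory.L2.inner_def]
  refine integral_congr_ae (Filter.Eventually.of_forall fun x => ?_)
  simp only [real_inner_self_eq_norm_sq, Real.norm_eq_abs, sq_abs]

/-- **Registered stub `stub_windowIneq` (PROVED; RH-FREE, ζ-free).** `‖𝖪[t]‖ < 1` for a representing operator gives the
window inequality of A1 for `MemLp` data on `(−t,t)` (zero-extend `f` to an `Lp` element; `‖F‖² = ∫ F²`). -/
theorem stub_windowIneq :
    ∀ K : ℝ → ℝ, Continuous K →
      ∀ T : ℝ → (Lp ℝ 2 (volume : Measure ℝ) →L[ℝ] Lp ℝ 2 (volume : Measure ℝ)),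
        (∀ t : ℝ, 0 ≤ t → ∀ f : Lp ℝ 2 (volume : Measure ℝ),
            ((T t f : Lp ℝ 2 (volume : Measure ℝ)) : ℝ → ℝ) =ᵐ[volume]
              fun x => (Ioo (-t) t).indicator (fun x => ∫ y in Ioo (-t) t, K (x + y) * f y) x) →
          ∀ t : ℝ, 0 ≤ t → ‖T t‖ < 1 → ∀ f : ℝ → ℝ,
            MemLp f 2 (volume.restrict (Ioo (-t) t)) →
              MemLp (fun x : ℝ => ∫ y in Ioo (-t) t, K (x + y) * f y) 2 (volume.restrict (Ioo (-t) t)) ∧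
                ∫ x in Ioo (-t) t, (∫ y in Ioo (-t) t, K (x + y) * f y) ^ 2 ≤ ∫ x in Ioo (-t) t, f x ^ 2 := by
  intro K _hK T hR t ht hn f hf
  set s : Set ℝ := Ioo (-t) t with hs_def
  have hs : MeasurableSet s := measurableSet_Ioo
  -- zero-extension of `f` as an element of `L²(ℝ)`
  have hfi : MemLp (s.indicator f) 2 (volume : Measure ℝ) := (memLp_indicator_iff_restrict hs).mpr hf
  set F : Lp ℝ 2 (volume : Measure ℝ) := hfi.toLp _ with hF_def
  have hFae : (F : ℝ → ℝ) =ᵐ[volume] s.indicator f := hfi.coeFn_toLp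
  -- the output function
  set g : ℝ → ℝ := fun x => ∫ y in s, K (x + y) * f y with hg_def
  -- the inner integrals for `F` and for `f` agree (for every `x`)
  have hinner : ∀ x : ℝ, ∫ y in s, K (x + y) * F y = g x := by
    intro x
    refine setIntegral_congr_ae hs ?_
    filter_upwards [hFae] with y hy hys
    rw [hy, indicator_of_mem hys]
  have hTF : ((T t F : Lp ℝ 2 (volume : Measure ℝ)) : ℝ → ℝ) =ᵐ[volume] s.indicator g := by
    filter_upwards [hR t ht F] with x hx
    rw [hx]
    by_cases hxs : x ∈ s
    · rw [indicator_of_mem hxs, indicator_of_mem hxs, hinner]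
    · rw [indicator_of_notMem hxs, indicator_of_notMem hxs]
  -- `MemLp` of the output on the window
  have hgi : MemLp (s.indicator g) 2 (volume : Measure ℝ) := (Lp.memLp (T t F)).ae_eq hTF
  have hg : MemLp g 2 (volume.restrict s) := (memLp_indicator_iff_restrict hs).mp hgi
  refine ⟨hg, ?_⟩
  -- norms as integrals of squares
  have hsq_ind : ∀ (h : ℝ → ℝ) (x : ℝ), (s.indicator h x) ^ 2 = s.indicator (fun x => h x ^ 2) x := by
    intro h x; by_cases hx : x ∈ s <;> simp [hx]
  have hF2 : ‖F‖ ^ 2 = ∫ x in s, f x ^ 2 := by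
    rw [norm_sq_eq_integral_sq,
      ← integral_indicator hs]
    refine integral_congr_ae ?_
    filter_upwards [hFae] with x hx
    rw [hx, hsq_ind]
  have hTF2 : ‖T t F‖ ^ 2 = ∫ x in s, g x ^ 2 := by
    rw [norm_sq_eq_integral_sq,
      ← integral_indicator hs]
    refine integral_congr_ae ?_
    filter_upwards [hTF] with x hx
    rw [hx, hsq_ind]
  -- contraction
  have hle : ‖T t F‖ ≤ ‖F‖ := by
    calc ‖T t F‖ ≤ ‖T t‖ * ‖F‖ := (T t).le_opNorm F
      _ ≤ 1 * ‖F‖ := by gcongr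
      _ = ‖F‖ := one_mul _
  have := pow_le_pow_left₀ (norm_nonneg _) hle 2
  rw [hTF2, hF2] at this
  simpa [hg_def] using this

/-- **Registered stub `stub_lineOfWindows` (PROVED; RH-FREE, ζ-free).** Exhaustion: the window inequalities on all
`(−(n+t), n+t)` give the `L²(ℝ)` membership and the line inequality (`AEStronglyMeasurable.iUnion`, `lintegral_iSup'`). -/
theorem stub_lineOfWindows :
    ∀ K : ℝ → ℝ, Continuous K →
      (∀ t : ℝ, 0 ≤ t → ∀ f : ℝ → ℝ,
          MemLp f 2 (volume.restrict (Ioo (-t) t)) →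
            MemLp (fun x : ℝ => ∫ y in Ioo (-t) t, K (x + y) * f y) 2 (volume.restrict (Ioo (-t) t)) ∧
              ∫ x in Ioo (-t) t, (∫ y in Ioo (-t) t, K (x + y) * f y) ^ 2 ≤ ∫ x in Ioo (-t) t, f x ^ 2) →
        ∀ t : ℝ, 0 ≤ t → ∀ f : ℝ → ℝ,
          MemLp f 2 (volume.restrict (Ioo (-t) t)) →
            MemLp (fun x : ℝ => ∫ y in Ioo (-t) t, K (x + y) * f y) 2 volume ∧
              ∫ x : ℝ, (∫ y in Ioo (-t) t, K (x + y) * f y) ^ 2 ≤ ∫ x in Ioo (-t) t, f x ^ 2 := by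
  intro K _hK hW t ht f hf
  set s : Set ℝ := Ioo (-t) t with hs_def
  have hs : MeasurableSet s := measurableSet_Ioo
  set g : ℝ → ℝ := fun x => ∫ y in s, K (x + y) * f y with hg_def
  set B : ℝ := ∫ x in s, f x ^ 2 with hB_def
  have hB0 : 0 ≤ B := setIntegral_nonneg hs fun x _ => sq_nonneg _
  -- zero-extension of `f`
  set fe : ℝ → ℝ := s.indicator f with hfe_def
  have hfei : MemLp fe 2 (volume : Measure ℝ) := (memLp_indicator_iff_restrict hs).mpr hf
  have hsq_ind : ∀ (h : ℝ → ℝ) (x : ℝ), (s.indicator h x) ^ 2 = s.indicator (fun x => h x ^ 2) x := by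
    intro h x; by_cases hx : x ∈ s <;> simp [hx]
  -- the window statement at any `T ≥ t`, applied to `fe`, speaks about `g`
  have hwin : ∀ T : ℝ, t ≤ T →
      MemLp g 2 (volume.restrict (Ioo (-T) T)) ∧ ∫ x in Ioo (-T) T, g x ^ 2 ≤ B := by
    intro T hT
    have hsub : s ⊆ Ioo (-T) T := Ioo_subset_Ioo (neg_le_neg hT) hT
    have hT0 : 0 ≤ T := ht.trans hT
    have hid : (fun x : ℝ => ∫ y in Ioo (-T) T, K (x + y) * fe y) = g := by
      funext x
      have : (fun y => K (x + y) * fe y) = s.indicator (fun y => K (x + y) * f y) := by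
        funext y; by_cases hy : y ∈ s <;> simp [hfe_def, hy]
      rw [this, setIntegral_indicator hs, inter_eq_right.mpr hsub]
    have hfe2 : ∫ x in Ioo (-T) T, fe x ^ 2 = B := by
      have : (fun x => fe x ^ 2) = s.indicator (fun x => f x ^ 2) := by
        funext x; rw [hfe_def, hsq_ind]
      rw [this, setIntegral_indicator hs, inter_eq_right.mpr hsub]
    have hid' : ∀ x : ℝ, ∫ y in Ioo (-T) T, K (x + y) * fe y = g x := fun x => congrFun hid x
    obtain ⟨h1, h2⟩ := hW T hT0 fe (hfei.restrict _)
    rw [hid] at h1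
    simp_rw [hid'] at h2
    rw [hfe2] at h2
    exact ⟨h1, h2⟩
  -- measurability of `g` on the line (exhaust ℝ by the windows `(−n,n)`, `n ≥ ⌈t⌉`)
  set N : ℕ → ℝ := fun n => (n : ℝ) + t with hN_def
  have hNt : ∀ n, t ≤ N n := fun n => by simp [hN_def]
  have hUnion : (⋃ n : ℕ, Ioo (-(N n)) (N n)) = univ := by
    refine eq_univ_of_forall fun x => mem_iUnion.mpr ?_
    obtain ⟨n, hn⟩ := exists_nat_gt |x|
    refine ⟨n, ?_, ?_⟩
    · have := neg_abs_le x; simp [hN_def]; linarith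
    · have := le_abs_self x; simp [hN_def]; linarith
  have hgm : AEStronglyMeasurable g (volume : Measure ℝ) := by
    have : AEStronglyMeasurable g ((volume : Measure ℝ).restrict (⋃ n : ℕ, Ioo (-(N n)) (N n))) :=
      AEStronglyMeasurable.iUnion fun n => (hwin (N n) (hNt n)).1.aestronglyMeasurable
    rwa [hUnion, Measure.restrict_univ] at this
  -- the Lebesgue integral of `g²` over ℝ is at most `B`
  set h : ℝ → ENNReal := fun x => ENNReal.ofReal (g x ^ 2) with hh_def
  have hhm : AEMeasurable h (volume : Measure ℝ) :=
    ENNReal.measurable_ofReal.comp_aemeasurable ((hgm.aemeasurable.pow_const 2))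
  have hwin_lint : ∀ n : ℕ, ∫⁻ x in Ioo (-(N n)) (N n), h x ≤ ENNReal.ofReal B := by
    intro n
    obtain ⟨h1, h2⟩ := hwin (N n) (hNt n)
    have hint : Integrable (fun x => g x ^ 2) (volume.restrict (Ioo (-(N n)) (N n))) :=
      (memLp_two_iff_integrable_sq h1.aestronglyMeasurable).mp h1
    rw [hh_def, ← ofReal_integral_eq_lintegral_ofReal hint (Filter.Eventually.of_forall fun x => sq_nonneg _)]
    exact ENNReal.ofReal_le_ofReal h2
  have hlint : ∫⁻ x, h x ≤ ENNReal.ofReal B := by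
    have hsup : (fun x => h x) = fun x => ⨆ n : ℕ, (Ioo (-(N n)) (N n)).indicator h x := by
      funext x
      apply le_antisymm
      · obtain ⟨n, hn⟩ := exists_nat_gt |x|
        have hx : x ∈ Ioo (-(N n)) (N n) := by
          have h1 := neg_abs_le x; have h2 := le_abs_self x
          constructor <;> simp [hN_def] <;> linarith
        exact le_iSup_of_le n (by rw [indicator_of_mem hx])
      · exact iSup_le fun n => indicator_le_self _ _ x
    have hmono : Monotone fun n : ℕ => (Ioo (-(N n)) (N n)).indicator h := by
      intro m n hmn x
      have hNmn : N m ≤ N n := by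
        have : (m : ℝ) ≤ n := Nat.cast_le.mpr hmn
        simp only [hN_def]; linarith
      exact indicator_le_indicator_of_subset (Ioo_subset_Ioo (neg_le_neg hNmn) hNmn) (fun _ => by simp) x
    rw [hsup, lintegral_iSup' (fun n => hhm.indicator measurableSet_Ioo)
      (Filter.Eventually.of_forall fun x m n hmn => hmono hmn x)]
    refine iSup_le fun n => ?_
    rw [lintegral_indicator measurableSet_Ioo]
    exact hwin_lint n
  -- conclude
  have hint : Integrable (fun x => g x ^ 2) (volume : Measure ℝ) := by
    refine ⟨hgm.pow _ |>.congr (by rfl), ?_⟩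
    rw [HasFiniteIntegral]
    calc ∫⁻ x, ‖g x ^ 2‖ₑ = ∫⁻ x, h x := by
          refine lintegral_congr fun x => ?_
          rw [hh_def, Real.enorm_eq_ofReal (sq_nonneg _)]
      _ ≤ ENNReal.ofReal B := hlint
      _ < ⊤ := ENNReal.ofReal_lt_top
  refine ⟨(memLp_two_iff_integrable_sq hgm).mpr hint, ?_⟩
  rw [integral_eq_lintegral_of_nonneg_ae (Filter.Eventually.of_forall fun x => sq_nonneg _) (hgm.pow 2)]
  exact ENNReal.toReal_le_of_le_ofReal hB0 hlint

end Summit.RiemannHypothesis.RiemannHypothesis.Cruxes.WindowsImplyContraction.Plumbing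

end
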